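import Summits.QuantumFields.YangMills.Theorems.BalabanUVNodesN21ThresholdMixtureCommonBoxRescale
import Summits.QuantumFields.YangMills.Theorems.BalabanUVNodesN21AtSpineCarriersMixtureTwoThresholds

/-!
# YM-DAG node N21 (= NE7c) — THE THRESHOLD MIXTURE, PART 5b: the TWO-THRESHOLD face (coupling-dependent thresholds `θ^A ≠ θ^B`) with the N20
# in-edge in print's currency — COMMON MULTIPLIERS, EACH RUN SHARP AT ITS OWN THRESHOLDS — and the K5 reading `S_N21 SRec`

Track A of `YM-PLAN.md` (cell `pub-ymgap`, HUMAN RULING D-0062), node **N21**; R141 (C) fan-out seat `pub-ymgap-dag-n21-e` (s3 = ALTERNATIVE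
CURRENCY), generation 3, file 11b.  Companions: file 8 `…N21AtSpineCarriersMixtureTwoThresholds` (p470362: `n21_knit_sharpMixture_twoThresholds`,
`s_N21_of_twoThresholdSharpMixtureReading` — each run averaged over ITS OWN box, `SiblingSuppression` of file 3's CLAMPED siblings as hypotheses),
file 11a `…N21ThresholdMixtureCommonBoxRescale` (`siblingSuppression_of_sharpCommonBox_Ioc`, `average_rescale_box`, the clamp letters).  Kernel
bookkeeping: 0 `def`, 0 `sorry`, standard axioms.  COUNT-NEUTRAL; `--supports` the K3′ item `SpineGivenEndpointR12` as a helper.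

WHAT THIS FILE DOES.  §1 `n21_knit_sharpMixture_twoThresholds_commonBox`: file 8's explicit-carrier knit with its two `SiblingSuppression` binders (on
the CLAMPED siblings of file 3 — an artefact of the threshold synchronisation) REPLACED by statements in print's own currency: occurrence data per
step (`nC K` occurrences, ages `aC`, run A's per-occurrence nominal thresholds `θCA > 0`, each term's INJECTIVE coordinate map `e K τ` consistent with
slots and with run A's thresholds), the two runs' FACTOR-REMOVAL sharp sibling weights `Sbs^A`, `Sbs^B` (the removed factor contributes file 3's
clamped shell — closed forms `1[u < θ]` ∕ `1` by file 3′ §0 `shell_small_clamp_eq_smallInd` ∕ `shell_large_clamp_eq_one` —, the OTHER factors are the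
run's OWN SHARP characteristic functions), and the SHARP class-relative bounds `hsharpA`, `hsharpB` for EVERY multiplier assignment of the half-open
common box: with `λ_c = S_c∕θCA_c ∈ (1 − κ_{aC c}, 1]` ONE multiplier per occurrence, run A is read at thresholds `λ_{e j}·θ^A_j = S_{e j}` and run B
at ITS OWN thresholds `λ_{e j}·θ^B_j = (θ^B_j∕θ^A_j)·S_{e j}`.  Internally: file 11a's clamp letters identify these with the sharp weights of file 3's
clamped variables on the half-open box, `average_rescale_box` re-pins run B's own-box carrier (file 8's `hB`) on run A's box, and
`siblingSuppression_of_sharpCommonBox_Ioc` (×2) feeds file 8 BY NAME.  §2 **`s_N21_of_twoThresholdSharpCommonBoxReading`**: `S_N21 SRec` for every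
carrier predicate handing that package.

HONEST FRAMING.  NE7c is NOT PRINTED and NOT PROVED.  Displayed binders (never discharged here): (O-mix-1) NODE O's threshold-free sharp
representations `hXs`∕`hSbs` at the ₁₂ record and the carrier pinnings; (O-mix-2) `SupClose` at `θ^A` (N16), the threshold gap `r` (U2 ∕ N17), the
sharp factor-removal bounds `hsharpA`∕`hsharpB` (N20, NE7b species — on the two-threshold face the displayed sibling is the cruder FACTOR-REMOVAL
weight, as file 3′ documented); (O-mix-3′) the occurrence structure.  The mixture is a convex combination of print's SHARP procedure over admissible
threshold vectors — NOT print verbatim; (M1) for the deterministic sharp procedure NOT claimed; N21 NOT discharged; count-neutral; one finite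
four-torus programme at fixed `ε`; NOT continuum ∕ ℝ⁴ ∕ OS ∕ mass gap ∕ Clay.

CITATION HEADER (lean-in-tree rule 2026-08-18).  BY NAME: file 8 `n21_knit_sharpMixture_twoThresholds`; file 11a `siblingSuppression_of_sharpCommonBox_Ioc`,
`ae_mem_Ioc_box_pi`, `average_rescale_box`, `prod_fac_clamp_eq`, `prod_fac_clamp_rescaled_eq`, `prod_ite_fac_clamp_eq`, `prod_ite_fac_clamp_rescaled_eq`;
file 10a `integrable_Xs_box`; `T4LipschitzCutoff.SiblingSuppression` ∕ `linProfile` ∕ `lipWeight`; `T4LipschitzLedger.SupClose` ∕ `sibW` ∕ `shellW` ∕ `Pol`;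
`T4IndicatorShell.ShellWeightBound` ∕ `smallInd`; `…ClustersCore` (`SpineCarriers`, `SpineRecordPred`, `S_N21`).  Context only (SHAPE): [Balaban1988Convergent]
(2.17)∕(2.18) p. 257; [Balaban1989LargeFieldI] (1.22) p. 181, p. 193.

WHAT IS PROVED ([folklore]).  §1 `n21_knit_sharpMixture_twoThresholds_commonBox` · §2 **`s_N21_of_twoThresholdSharpCommonBoxReading`**.
-/

set_option autoImplicit false

noncomputable section

open MeasureTheory Set
open scoped BigOperators ENNReal

namespace Summit.QuantumFields.YangMills.Theorems.N21AtSpineCarriersMixtureTwoThresholdsCommonBox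

open YMDAG.UVSplit (SpineCarriers SpineRecordPred S_N21)
open Literature.MathematicalPhysics.QuantumFieldTheory.Balaban1983to89
open Literature.MathematicalPhysics.QuantumFieldTheory.Balaban1983to89.T4LipschitzCutoff
open Literature.MathematicalPhysics.QuantumFieldTheory.Balaban1983to89.T4IndicatorShell
open Literature.MathematicalPhysics.QuantumFieldTheory.Balaban1983to89.T4LipschitzLedger
open N21ThresholdMixtureCommonBox (integrable_Xs_box)
open N21ThresholdMixtureCommonBoxRescale (siblingSuppression_of_sharpCommonBox_Ioc ae_mem_Ioc_box_pi average_rescale_box prod_fac_clamp_eq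
  prod_fac_clamp_rescaled_eq prod_ite_fac_clamp_eq prod_ite_fac_clamp_rescaled_eq)
open N21AtSpineCarriersMixtureTwoThresholds (n21_knit_sharpMixture_twoThresholds)

/-! ## §1 Explicit carriers: the two-threshold (η) knit with N20 in print's currency at common multipliers -/

section Explicit

variable {ι : Type*} {Ω : ℕ → ι → Type*} [∀ K τ, MeasurableSpace (Ω K τ)]
  {l₀ : ℝ} {T : ℕ → Finset ι} {A B shA shB : ℕ → ℝ → ι → ℝ} {κ : ℕ → ℝ} {N : ℕ} {n : ℕ → ℕ}
  {μ : (K : ℕ) → (τ : ι) → Measure (Ω K τ)} [∀ K τ, SFinite (μ K τ)] {m : ℕ → ι → ℕ} {slot : ℕ → ι → ℕ → Σ _ : ℕ, ℕ}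
  {pol : ℕ → ι → ℕ → Pol} {θA θB : ℕ → ι → ℕ → ℝ} {uA uB : (K : ℕ) → (τ : ι) → ℕ → Ω K τ → ℝ}
  {RA RB : (K : ℕ) → ℝ → (τ : ι) → Ω K τ → ℝ} {ρ r S : ℕ → ℝ}
  {nC : ℕ → ℕ} {aC : ℕ → ℕ → ℕ} {θCA : ℕ → ℕ → ℝ} {e : (K : ℕ) → (τ : ι) → Fin (m K τ) → Fin (nC K)}

/-- **N21 KNIT, TWO THRESHOLD FAMILIES, EXPLICIT CARRIERS, N20 IN PRINT's CURRENCY AT COMMON MULTIPLIERS.**  File 8's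
`n21_knit_sharpMixture_twoThresholds` (run A's sharp weights averaged over `⊗_i Leb|[(1−κ_{a_i})θ^A_i, θ^A_i]`, run B's over its own box at `θ^B`,
gap `|θ^A_i − θ^B_i| ≤ r(K − a_i)θ^A_i`, `SupClose` at `θ^A`, clamped shell parts pinned) with its two `SiblingSuppression` binders REPLACED by:
occurrence data (`nC`, `aC`, run A's nominal thresholds `θCA > 0`, injective `e K τ` with `(slot K τ j).1 = aC K (e K τ j)`, `θ^A K τ j = θCA K (e K τ j)`),
the FACTOR-REMOVAL sharp sibling weights `Sbs^A` (`hSbsA`: removed factor `i` ↦ file 3's clamped shell at width `(ρ + r)θ^A_i`, other factors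
`1[u^A_j < s_j]` SHARP) and `Sbs^B` (`hSbsB`: removed factor ↦ the clamped-rescaled shell, other factors `1[u^B_j < s_j]` SHARP at run B's own
thresholds), and the SHARP class-relative bounds for every `S` in the HALF-OPEN common box `∏_c ((1 − κ_{aC c})θCA_c, θCA_c]`:
`hsharpA : Σ_τ Sbs^A σ K t τ (S ∘ e) ≤ Ssup(σ.1)·Σ_τ Xs^A K t τ (S ∘ e)` and `hsharpB : Σ_τ Sbs^B σ K t τ ((θ^B∕θ^A)·(S ∘ e)) ≤ Ssup(σ.1)·Σ_τ Xs^B K t τ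
((θ^B∕θ^A)·(S ∘ e))` — run B at ITS OWN thresholds times the common multipliers.  THEN `ShellWeightBound l₀ T A B shA shB Wsh` for every summable
`Wsh` above the band weight at width `ρ + r`.  CONDITIONAL on every displayed binder; NE7c NOT proved. [folklore] -/
theorem n21_knit_sharpMixture_twoThresholds_commonBox (XsA XsB : (K : ℕ) → ℝ → (τ : ι) → (Fin (m K τ) → ℝ) → ℝ)
    (SbsA SbsB : (Σ _ : ℕ, ℕ) → (K : ℕ) → ℝ → (τ : ι) → (Fin (m K τ) → ℝ) → ℝ) (hκ : ∀ a, 0 < κ a ∧ κ a < 1)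
    (thrA_pos : ∀ K, ∀ τ ∈ T K, ∀ i < m K τ, 0 < θA K τ i) (thrB_pos : ∀ K, ∀ τ ∈ T K, ∀ i < m K τ, 0 < θB K τ i)
    (slot_mem : ∀ K, ∀ τ ∈ T K, ∀ i < m K τ, slot K τ i ∈ (Finset.range (N + 1)).sigma fun a => Finset.range (n a))
    (slot_band : ∀ K, ∀ τ ∈ T K, ∀ i < m K τ, (slot K τ i).1 ≤ K)
    (meas : ∀ K, ∀ τ ∈ T K, ∀ i < m K τ, Measurable (uA K τ i) ∧ Measurable (uB K τ i))
    (remA_nonneg : ∀ K t, |t| ≤ l₀ → ∀ τ ∈ T K, 0 ≤ᵐ[μ K τ] RA K t τ)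
    (remA_int : ∀ K t, |t| ≤ l₀ → ∀ τ ∈ T K, Integrable (RA K t τ) (μ K τ))
    (remB_nonneg : ∀ K t, |t| ≤ l₀ → ∀ τ ∈ T K, 0 ≤ᵐ[μ K τ] RB K t τ)
    (remB_int : ∀ K t, |t| ≤ l₀ → ∀ τ ∈ T K, Integrable (RB K t τ) (μ K τ))
    (hXsA : ∀ K t, |t| ≤ l₀ → ∀ τ ∈ T K, ∀ s : Fin (m K τ) → ℝ,
      XsA K t τ s = ∫ v, (∏ i : Fin (m K τ), (pol K τ i).fac (smallInd (uA K τ i v) (s i))) * RA K t τ v ∂(μ K τ))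
    (hXsB : ∀ K t, |t| ≤ l₀ → ∀ τ ∈ T K, ∀ s : Fin (m K τ) → ℝ,
      XsB K t τ s = ∫ v, (∏ i : Fin (m K τ), (pol K τ i).fac (smallInd (uB K τ i v) (s i))) * RB K t τ v ∂(μ K τ))
    (hA : ∀ K t, |t| ≤ l₀ → ∀ τ ∈ T K, A K t τ =
      (∏ i : Fin (m K τ), (κ (slot K τ i).1 * θA K τ i))⁻¹ *
        ∫ s, XsA K t τ s ∂(Measure.pi fun i : Fin (m K τ) =>
          volume.restrict (Icc ((1 - κ (slot K τ i).1) * θA K τ i) (θA K τ i))))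
    (hB : ∀ K t, |t| ≤ l₀ → ∀ τ ∈ T K, B K t τ =
      (∏ i : Fin (m K τ), (κ (slot K τ i).1 * θB K τ i))⁻¹ *
        ∫ s, XsB K t τ s ∂(Measure.pi fun i : Fin (m K τ) =>
          volume.restrict (Icc ((1 - κ (slot K τ i).1) * θB K τ i) (θB K τ i))))
    (hF : SupClose T μ m slot θA uA uB ρ)
    (hθ : ∀ K, ∀ τ ∈ T K, ∀ i < m K τ, |θA K τ i - θB K τ i| ≤ r (K - (slot K τ i).1) * θA K τ i)
    -- the FACTOR-REMOVAL sharp sibling weights of the two runs (file 9's letters; the removed factor carries file 3's clamped shell)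
    (hSbsA : ∀ σ K t, |t| ≤ l₀ → ∀ τ ∈ T K, ∀ s : Fin (m K τ) → ℝ,
      SbsA σ K t τ s = ∑ i ∈ (Finset.range (m K τ)).filter (fun i => slot K τ i = σ),
          ∫ v, (pol K τ i).shell (max ((1 - κ (slot K τ i).1) * θA K τ i) (min (θA K τ i) (uA K τ i v))) (θA K τ i) (κ (slot K τ i).1)
              ((ρ (K - (slot K τ i).1) + r (K - (slot K τ i).1)) * θA K τ i) *
            (∏ j : Fin (m K τ), (if (j : ℕ) = i then (1 : ℝ) else (pol K τ j).fac (smallInd (uA K τ j v) (s j)))) *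
              RA K t τ v ∂(μ K τ))
    (hSbsB : ∀ σ K t, |t| ≤ l₀ → ∀ τ ∈ T K, ∀ s : Fin (m K τ) → ℝ,
      SbsB σ K t τ s = ∑ i ∈ (Finset.range (m K τ)).filter (fun i => slot K τ i = σ),
          ∫ v, (pol K τ i).shell (max ((1 - κ (slot K τ i).1) * θA K τ i) (min (θA K τ i) (θA K τ i / θB K τ i * uB K τ i v)))
              (θA K τ i) (κ (slot K τ i).1) ((ρ (K - (slot K τ i).1) + r (K - (slot K τ i).1)) * θA K τ i) *
            (∏ j : Fin (m K τ), (if (j : ℕ) = i then (1 : ℝ) else (pol K τ j).fac (smallInd (uB K τ j v) (s j)))) *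
              RB K t τ v ∂(μ K τ))
    -- occurrence data: ONE multiplier per occurrence; each term reads its own occurrences injectively, at run A's nominal thresholds
    (hθCA : ∀ K c, 0 < θCA K c) (he : ∀ K, ∀ τ ∈ T K, Function.Injective (e K τ))
    (he_age : ∀ K, ∀ τ ∈ T K, ∀ j : Fin (m K τ), (slot K τ j).1 = aC K (e K τ j))
    (he_thrA : ∀ K, ∀ τ ∈ T K, ∀ j : Fin (m K τ), θA K τ j = θCA K (e K τ j))
    -- N20 in print's currency: SHARP class-relative bounds at every multiplier assignment of the half-open common box, each run at its thresholds
    (hsharpA : ∀ σ ∈ (Finset.range (N + 1)).sigma (fun a => Finset.range (n a)), ∀ K t, |t| ≤ l₀ →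
      ∀ Sv : Fin (nC K) → ℝ, (∀ c : Fin (nC K), Sv c ∈ Ioc ((1 - κ (aC K c)) * θCA K c) (θCA K c)) →
        ∑ τ ∈ T K, SbsA σ K t τ (fun j => Sv (e K τ j)) ≤ S σ.1 * ∑ τ ∈ T K, XsA K t τ (fun j => Sv (e K τ j)))
    (hsharpB : ∀ σ ∈ (Finset.range (N + 1)).sigma (fun a => Finset.range (n a)), ∀ K t, |t| ≤ l₀ →
      ∀ Sv : Fin (nC K) → ℝ, (∀ c : Fin (nC K), Sv c ∈ Ioc ((1 - κ (aC K c)) * θCA K c) (θCA K c)) →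
        ∑ τ ∈ T K, SbsB σ K t τ (fun j => θB K τ j / θA K τ j * Sv (e K τ j)) ≤
          S σ.1 * ∑ τ ∈ T K, XsB K t τ (fun j => θB K τ j / θA K τ j * Sv (e K τ j)))
    (hS : ∀ a ≤ N, 0 ≤ S a) (hρ0 : ∀ j, 0 ≤ ρ j) (hr0 : ∀ j, 0 ≤ r j) (hρ : Summable ρ) (hr : Summable r)
    (hshA : shA = shellW (fun a => linProfile (κ a)) μ m slot pol θA
      (fun K τ i v => max ((1 - κ (slot K τ i).1) * θA K τ i) (min (θA K τ i) (uA K τ i v)))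
      (fun K τ i v => max ((1 - κ (slot K τ i).1) * θA K τ i) (min (θA K τ i) (θA K τ i / θB K τ i * uB K τ i v))) RA)
    (hshB : shB = shellW (fun a => linProfile (κ a)) μ m slot pol θA
      (fun K τ i v => max ((1 - κ (slot K τ i).1) * θA K τ i) (min (θA K τ i) (θA K τ i / θB K τ i * uB K τ i v)))
      (fun K τ i v => max ((1 - κ (slot K τ i).1) * θA K τ i) (min (θA K τ i) (uA K τ i v))) RB)
    {Wsh : ℕ → ℝ}
    (hWsh : ∀ K, ∑ a ∈ Finset.range (N + 1), (n a : ℝ) * lipWeight (fun a => (κ a)⁻¹) S (fun j => ρ j + r j) a K ≤ Wsh K)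
    (hsum : Summable Wsh) : ShellWeightBound l₀ T A B shA shB Wsh := by
  -- the clamped variables are measurable
  have measA' : ∀ K, ∀ τ ∈ T K, ∀ i < m K τ,
      Measurable fun v => max ((1 - κ (slot K τ i).1) * θA K τ i) (min (θA K τ i) (uA K τ i v)) :=
    fun K τ hτ i hi => measurable_const.max (measurable_const.min (meas K τ hτ i hi).1)
  have measB' : ∀ K, ∀ τ ∈ T K, ∀ i < m K τ,
      Measurable fun v => max ((1 - κ (slot K τ i).1) * θA K τ i) (min (θA K τ i) (θA K τ i / θB K τ i * uB K τ i v)) :=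
    fun K τ hτ i hi => measurable_const.max (measurable_const.min ((meas K τ hτ i hi).2.const_mul _))
  -- each term's threshold sub-vector of a half-open common vector lies in the term's half-open box (run A's letters)
  have hsub : ∀ K, ∀ τ ∈ T K, ∀ Sv : Fin (nC K) → ℝ, (∀ c : Fin (nC K), Sv c ∈ Ioc ((1 - κ (aC K c)) * θCA K c) (θCA K c)) →
      ∀ j : Fin (m K τ), Sv (e K τ j) ∈ Ioc ((1 - κ (slot K τ j).1) * θA K τ j) (θA K τ j) := by
    intro K τ hτ Sv hSv j
    rw [he_age K τ hτ j, he_thrA K τ hτ j]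
    exact hSv (e K τ j)
  refine n21_knit_sharpMixture_twoThresholds XsA XsB hκ thrA_pos thrB_pos slot_mem slot_band meas remA_nonneg remA_int remB_nonneg
    remB_int hXsA hXsB hA hB hF hθ ?_ ?_ hS hρ0 hr0 hρ hr hshA hshB hWsh hsum
  · -- RUN A: the (η) face's sibling suppression of the clamped siblings from `hsharpA`, on the half-open common box
    refine siblingSuppression_of_sharpCommonBox_Ioc
      (fun K t τ s => ∫ v, (∏ i : Fin (m K τ), (pol K τ i).fac
        (smallInd (max ((1 - κ (slot K τ i).1) * θA K τ i) (min (θA K τ i) (uA K τ i v))) (s i))) * RA K t τ v ∂(μ K τ))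
      (fun σ K t τ s => ∑ i ∈ (Finset.range (m K τ)).filter (fun i => slot K τ i = σ),
        ∫ v, (pol K τ i).shell (max ((1 - κ (slot K τ i).1) * θA K τ i) (min (θA K τ i) (uA K τ i v))) (θA K τ i) (κ (slot K τ i).1)
            ((fun j => ρ j + r j) (K - (slot K τ i).1) * θA K τ i) *
          (∏ j : Fin (m K τ), (if (j : ℕ) = i then (1 : ℝ) else (pol K τ j).fac
            (smallInd (max ((1 - κ (slot K τ j).1) * θA K τ j) (min (θA K τ j) (uA K τ j v))) (s j)))) * RA K t τ v ∂(μ K τ))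
      (fun a => (hκ a).1) thrA_pos measA' remA_int (fun _ _ _ _ _ _ => rfl) ?_ (fun _ _ _ _ _ _ _ => rfl) hθCA he he_age he_thrA ?_
    · -- run A's carrier IS the normalised average of the CLAMPED sharp weights (they agree on the half-open box)
      intro K t ht τ hτ
      rw [hA K t ht τ hτ]
      congr 1
      refine integral_congr_ae ?_
      filter_upwards [ae_mem_Ioc_box_pi (fun i : Fin (m K τ) => (1 - κ (slot K τ i).1) * θA K τ i) (fun i => θA K τ i)] with s hs
      rw [hXsA K t ht τ hτ s]
      refine integral_congr_ae (ae_of_all _ fun v => ?_)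
      simp only
      rw [prod_fac_clamp_eq (fun i => pol K τ i) (fun i => κ (slot K τ i).1) (fun i => θA K τ i) (fun i => uA K τ i v) s hs]
    · -- `hsharpA` in the clamped letters
      intro σ hσ K t ht Sv hSv
      have hXe : ∀ τ ∈ T K,
          (∫ v, (∏ i : Fin (m K τ), (pol K τ i).fac (smallInd (max ((1 - κ (slot K τ i).1) * θA K τ i)
              (min (θA K τ i) (uA K τ i v))) (Sv (e K τ i)))) * RA K t τ v ∂(μ K τ)) = XsA K t τ (fun j => Sv (e K τ j)) := by
        intro τ hτ
        rw [hXsA K t ht τ hτ]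
        refine integral_congr_ae (ae_of_all _ fun v => ?_)
        simp only
        rw [prod_fac_clamp_eq (fun i => pol K τ i) (fun i => κ (slot K τ i).1) (fun i => θA K τ i) (fun i => uA K τ i v)
          (fun j => Sv (e K τ j)) (hsub K τ hτ Sv hSv)]
      have hSe : ∀ τ ∈ T K,
          (∑ i ∈ (Finset.range (m K τ)).filter (fun i => slot K τ i = σ),
            ∫ v, (pol K τ i).shell (max ((1 - κ (slot K τ i).1) * θA K τ i) (min (θA K τ i) (uA K τ i v))) (θA K τ i) (κ (slot K τ i).1)
                ((fun j => ρ j + r j) (K - (slot K τ i).1) * θA K τ i) *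
              (∏ j : Fin (m K τ), (if (j : ℕ) = i then (1 : ℝ) else (pol K τ j).fac
                (smallInd (max ((1 - κ (slot K τ j).1) * θA K τ j) (min (θA K τ j) (uA K τ j v))) (Sv (e K τ j))))) * RA K t τ v ∂(μ K τ)) =
            SbsA σ K t τ (fun j => Sv (e K τ j)) := by
        intro τ hτ
        rw [hSbsA σ K t ht τ hτ]
        refine Finset.sum_congr rfl fun i _ => integral_congr_ae (ae_of_all _ fun v => ?_)
        simp only
        rw [prod_ite_fac_clamp_eq (fun j => pol K τ j) (fun j => κ (slot K τ j).1) (fun j => θA K τ j) (fun j => uA K τ j v)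
          (fun j => Sv (e K τ j)) (hsub K τ hτ Sv hSv) i]
      rw [Finset.sum_congr rfl hSe, Finset.sum_congr rfl hXe]
      exact hsharpA σ hσ K t ht Sv hSv
  · -- RUN B: the clamped-rescaled siblings from `hsharpB` — run B sharp at its own thresholds, re-pinned on run A's box by `average_rescale_box`
    refine siblingSuppression_of_sharpCommonBox_Ioc
      (fun K t τ s => ∫ v, (∏ i : Fin (m K τ), (pol K τ i).fac
        (smallInd (max ((1 - κ (slot K τ i).1) * θA K τ i) (min (θA K τ i) (θA K τ i / θB K τ i * uB K τ i v))) (s i))) *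
          RB K t τ v ∂(μ K τ))
      (fun σ K t τ s => ∑ i ∈ (Finset.range (m K τ)).filter (fun i => slot K τ i = σ),
        ∫ v, (pol K τ i).shell (max ((1 - κ (slot K τ i).1) * θA K τ i) (min (θA K τ i) (θA K τ i / θB K τ i * uB K τ i v))) (θA K τ i)
            (κ (slot K τ i).1) ((fun j => ρ j + r j) (K - (slot K τ i).1) * θA K τ i) *
          (∏ j : Fin (m K τ), (if (j : ℕ) = i then (1 : ℝ) else (pol K τ j).fac
            (smallInd (max ((1 - κ (slot K τ j).1) * θA K τ j) (min (θA K τ j) (θA K τ j / θB K τ j * uB K τ j v))) (s j)))) *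
            RB K t τ v ∂(μ K τ))
      (fun a => (hκ a).1) thrA_pos measB' remB_int (fun _ _ _ _ _ _ => rfl) ?_ (fun _ _ _ _ _ _ _ => rfl) hθCA he he_age he_thrA ?_
    · -- run B's OWN-box carrier re-pinned on run A's box
      intro K t ht τ hτ
      have hf : AEStronglyMeasurable (XsB K t τ)
          (Measure.pi fun i : Fin (m K τ) => (volume : Measure ℝ).restrict (Icc ((1 - κ (slot K τ i).1) * θB K τ i) (θB K τ i))) :=
        (integrable_Xs_box XsB (fun i hi => (meas K τ hτ i hi).2) (remB_int K t ht τ hτ) (hXsB K t ht τ hτ) _ _).aestronglyMeasurable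
      have key : (∏ i : Fin (m K τ), (κ (slot K τ i).1 * θA K τ i))⁻¹ *
          ∫ s, XsB K t τ (fun i => θB K τ i / θA K τ i * s i)
            ∂(Measure.pi fun i : Fin (m K τ) => (volume : Measure ℝ).restrict (Icc ((1 - κ (slot K τ i).1) * θA K τ i) (θA K τ i))) =
          (∏ i : Fin (m K τ), (κ (slot K τ i).1 * θB K τ i))⁻¹ *
            ∫ x, XsB K t τ x ∂(Measure.pi fun i : Fin (m K τ) =>
              (volume : Measure ℝ).restrict (Icc ((1 - κ (slot K τ i).1) * θB K τ i) (θB K τ i))) :=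
        average_rescale_box (fun i : Fin (m K τ) => κ (slot K τ i).1) (fun i => θA K τ i) (fun i => θB K τ i) (fun i => (hκ _).1)
          (fun i => thrA_pos K τ hτ i i.2) (fun i => thrB_pos K τ hτ i i.2) hf
      rw [hB K t ht τ hτ, ← key]
      congr 1
      refine integral_congr_ae ?_
      filter_upwards [ae_mem_Ioc_box_pi (fun i : Fin (m K τ) => (1 - κ (slot K τ i).1) * θA K τ i) (fun i => θA K τ i)] with s hs
      rw [hXsB K t ht τ hτ]
      refine integral_congr_ae (ae_of_all _ fun v => ?_)
      simp only
      rw [prod_fac_clamp_rescaled_eq (fun i => pol K τ i) (fun i => κ (slot K τ i).1) (fun i => θA K τ i) (fun i => θB K τ i)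
        (fun i => uB K τ i v) s (fun i => thrA_pos K τ hτ i i.2) (fun i => thrB_pos K τ hτ i i.2) hs]
    · -- `hsharpB` in the clamped-rescaled letters
      intro σ hσ K t ht Sv hSv
      have hXe : ∀ τ ∈ T K,
          (∫ v, (∏ i : Fin (m K τ), (pol K τ i).fac (smallInd (max ((1 - κ (slot K τ i).1) * θA K τ i)
              (min (θA K τ i) (θA K τ i / θB K τ i * uB K τ i v))) (Sv (e K τ i)))) * RB K t τ v ∂(μ K τ)) =
            XsB K t τ (fun j => θB K τ j / θA K τ j * Sv (e K τ j)) := by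
        intro τ hτ
        rw [hXsB K t ht τ hτ]
        refine integral_congr_ae (ae_of_all _ fun v => ?_)
        simp only
        rw [prod_fac_clamp_rescaled_eq (fun i => pol K τ i) (fun i => κ (slot K τ i).1) (fun i => θA K τ i) (fun i => θB K τ i)
          (fun i => uB K τ i v) (fun j => Sv (e K τ j)) (fun i => thrA_pos K τ hτ i i.2) (fun i => thrB_pos K τ hτ i i.2)
          (hsub K τ hτ Sv hSv)]
      have hSe : ∀ τ ∈ T K,
          (∑ i ∈ (Finset.range (m K τ)).filter (fun i => slot K τ i = σ),
            ∫ v, (pol K τ i).shell (max ((1 - κ (slot K τ i).1) * θA K τ i) (min (θA K τ i) (θA K τ i / θB K τ i * uB K τ i v)))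
                (θA K τ i) (κ (slot K τ i).1) ((fun j => ρ j + r j) (K - (slot K τ i).1) * θA K τ i) *
              (∏ j : Fin (m K τ), (if (j : ℕ) = i then (1 : ℝ) else (pol K τ j).fac
                (smallInd (max ((1 - κ (slot K τ j).1) * θA K τ j) (min (θA K τ j) (θA K τ j / θB K τ j * uB K τ j v)))
                  (Sv (e K τ j))))) * RB K t τ v ∂(μ K τ)) =
            SbsB σ K t τ (fun j => θB K τ j / θA K τ j * Sv (e K τ j)) := by
        intro τ hτ
        rw [hSbsB σ K t ht τ hτ]
        refine Finset.sum_congr rfl fun i _ => integral_congr_ae (ae_of_all _ fun v => ?_)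
        simp only
        rw [prod_ite_fac_clamp_rescaled_eq (fun j => pol K τ j) (fun j => κ (slot K τ j).1) (fun j => θA K τ j) (fun j => θB K τ j)
          (fun j => uB K τ j v) (fun j => Sv (e K τ j)) (fun j => thrA_pos K τ hτ j j.2) (fun j => thrB_pos K τ hτ j j.2)
          (hsub K τ hτ Sv hSv) i]
      rw [Finset.sum_congr rfl hSe, Finset.sum_congr rfl hXe]
      exact hsharpB σ hσ K t ht Sv hSv

end Explicit

/-! ## §2 At the spine carriers: `S_N21 SRec` for every two-threshold common-box sharp-mixture reading -/

section AtCarriers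

variable {N : ℕ} [NeZero N]

/-- **`S_N21` FOR EVERY TWO-THRESHOLD COMMON-BOX SHARP-MIXTURE READING.**  File 8's `s_N21_of_twoThresholdSharpMixtureReading` with the two
profiled∕clamped `SiblingSuppression` conjuncts REPLACED by: occurrence data (`nC`, `aC`, run A's nominal thresholds `θCA > 0`, injective consistent
`e`), the factor-removal sharp sibling weights `Sbs^A`, `Sbs^B`, and the SHARP class-relative bounds at every multiplier assignment of the half-open
common box — run A at `S ∘ e`, run B at its OWN thresholds `(θ^B∕θ^A)·(S ∘ e)`.  Then `S_N21 SRec` (§1).  NO (M1), NO profiled tower, N20 read in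
print's currency on BOTH runs. [folklore] -/
theorem s_N21_of_twoThresholdSharpCommonBoxReading (SRec : SpineRecordPred N)
    (hread : ∀ (F : T4Continuum.T4Family) (D : YMDAG.UVSplit.Datum F N) (g₀ : ℕ → ℝ)
      (os : List (T4Continuum.ULoop F)) (S : SpineCarriers), SRec F D g₀ os S →
      ∃ (Ω : ℕ → S.ι → Type) (_mΩ : ∀ K τ, MeasurableSpace (Ω K τ)) (μ : (K : ℕ) → (τ : S.ι) → Measure (Ω K τ))
        (_sf : ∀ K τ, SFinite (μ K τ)) (κ : ℕ → ℝ) (Nw : ℕ) (n : ℕ → ℕ) (m : ℕ → S.ι → ℕ) (slot : ℕ → S.ι → ℕ → Σ _ : ℕ, ℕ)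
        (pol : ℕ → S.ι → ℕ → Pol) (θA θB : ℕ → S.ι → ℕ → ℝ) (uA uB : (K : ℕ) → (τ : S.ι) → ℕ → Ω K τ → ℝ)
        (RA RB : (K : ℕ) → ℝ → (τ : S.ι) → Ω K τ → ℝ) (XsA XsB : (K : ℕ) → ℝ → (τ : S.ι) → (Fin (m K τ) → ℝ) → ℝ)
        (ρ r Ssup : ℕ → ℝ) (nC : ℕ → ℕ) (aC : ℕ → ℕ → ℕ) (θCA : ℕ → ℕ → ℝ) (e : (K : ℕ) → (τ : S.ι) → Fin (m K τ) → Fin (nC K))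
        (SbsA SbsB : (Σ _ : ℕ, ℕ) → (K : ℕ) → ℝ → (τ : S.ι) → (Fin (m K τ) → ℝ) → ℝ),
        (∀ a, 0 < κ a ∧ κ a < 1) ∧
        (∀ K, ∀ τ ∈ S.T K, ∀ i < m K τ, 0 < θA K τ i) ∧ (∀ K, ∀ τ ∈ S.T K, ∀ i < m K τ, 0 < θB K τ i) ∧
        (∀ K, ∀ τ ∈ S.T K, ∀ i < m K τ, slot K τ i ∈ (Finset.range (Nw + 1)).sigma fun a => Finset.range (n a)) ∧
        (∀ K, ∀ τ ∈ S.T K, ∀ i < m K τ, (slot K τ i).1 ≤ K) ∧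
        (∀ K, ∀ τ ∈ S.T K, ∀ i < m K τ, Measurable (uA K τ i) ∧ Measurable (uB K τ i)) ∧
        (∀ K t, |t| ≤ S.l₀ → ∀ τ ∈ S.T K, 0 ≤ᵐ[μ K τ] RA K t τ) ∧
        (∀ K t, |t| ≤ S.l₀ → ∀ τ ∈ S.T K, Integrable (RA K t τ) (μ K τ)) ∧
        (∀ K t, |t| ≤ S.l₀ → ∀ τ ∈ S.T K, 0 ≤ᵐ[μ K τ] RB K t τ) ∧
        (∀ K t, |t| ≤ S.l₀ → ∀ τ ∈ S.T K, Integrable (RB K t τ) (μ K τ)) ∧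
        (∀ K t, |t| ≤ S.l₀ → ∀ τ ∈ S.T K, ∀ s : Fin (m K τ) → ℝ,
          XsA K t τ s = ∫ v, (∏ i : Fin (m K τ), (pol K τ i).fac (smallInd (uA K τ i v) (s i))) * RA K t τ v ∂(μ K τ)) ∧
        (∀ K t, |t| ≤ S.l₀ → ∀ τ ∈ S.T K, ∀ s : Fin (m K τ) → ℝ,
          XsB K t τ s = ∫ v, (∏ i : Fin (m K τ), (pol K τ i).fac (smallInd (uB K τ i v) (s i))) * RB K t τ v ∂(μ K τ)) ∧
        (∀ K t, |t| ≤ S.l₀ → ∀ τ ∈ S.T K, S.A K t τ =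
          (∏ i : Fin (m K τ), (κ (slot K τ i).1 * θA K τ i))⁻¹ *
            ∫ s, XsA K t τ s ∂(Measure.pi fun i : Fin (m K τ) =>
              volume.restrict (Icc ((1 - κ (slot K τ i).1) * θA K τ i) (θA K τ i)))) ∧
        (∀ K t, |t| ≤ S.l₀ → ∀ τ ∈ S.T K, S.B K t τ =
          (∏ i : Fin (m K τ), (κ (slot K τ i).1 * θB K τ i))⁻¹ *
            ∫ s, XsB K t τ s ∂(Measure.pi fun i : Fin (m K τ) =>
              volume.restrict (Icc ((1 - κ (slot K τ i).1) * θB K τ i) (θB K τ i)))) ∧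
        SupClose S.T μ m slot θA uA uB ρ ∧
        (∀ K, ∀ τ ∈ S.T K, ∀ i < m K τ, |θA K τ i - θB K τ i| ≤ r (K - (slot K τ i).1) * θA K τ i) ∧
        -- the factor-removal sharp sibling weights of the two runs
        (∀ σ K t, |t| ≤ S.l₀ → ∀ τ ∈ S.T K, ∀ s : Fin (m K τ) → ℝ,
          SbsA σ K t τ s = ∑ i ∈ (Finset.range (m K τ)).filter (fun i => slot K τ i = σ),
            ∫ v, (pol K τ i).shell (max ((1 - κ (slot K τ i).1) * θA K τ i) (min (θA K τ i) (uA K τ i v))) (θA K τ i) (κ (slot K τ i).1)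
                ((ρ (K - (slot K τ i).1) + r (K - (slot K τ i).1)) * θA K τ i) *
              (∏ j : Fin (m K τ), (if (j : ℕ) = i then (1 : ℝ) else (pol K τ j).fac (smallInd (uA K τ j v) (s j)))) *
                RA K t τ v ∂(μ K τ)) ∧
        (∀ σ K t, |t| ≤ S.l₀ → ∀ τ ∈ S.T K, ∀ s : Fin (m K τ) → ℝ,
          SbsB σ K t τ s = ∑ i ∈ (Finset.range (m K τ)).filter (fun i => slot K τ i = σ),
            ∫ v, (pol K τ i).shell (max ((1 - κ (slot K τ i).1) * θA K τ i) (min (θA K τ i) (θA K τ i / θB K τ i * uB K τ i v)))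
                (θA K τ i) (κ (slot K τ i).1) ((ρ (K - (slot K τ i).1) + r (K - (slot K τ i).1)) * θA K τ i) *
              (∏ j : Fin (m K τ), (if (j : ℕ) = i then (1 : ℝ) else (pol K τ j).fac (smallInd (uB K τ j v) (s j)))) *
                RB K t τ v ∂(μ K τ)) ∧
        -- (O-mix-3′) the occurrence structure; N20 in print's currency, both runs at common multipliers
        (∀ K c, 0 < θCA K c) ∧ (∀ K, ∀ τ ∈ S.T K, Function.Injective (e K τ)) ∧
        (∀ K, ∀ τ ∈ S.T K, ∀ j : Fin (m K τ), (slot K τ j).1 = aC K (e K τ j)) ∧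
        (∀ K, ∀ τ ∈ S.T K, ∀ j : Fin (m K τ), θA K τ j = θCA K (e K τ j)) ∧
        (∀ σ ∈ (Finset.range (Nw + 1)).sigma (fun a => Finset.range (n a)), ∀ K t, |t| ≤ S.l₀ →
          ∀ Sv : Fin (nC K) → ℝ, (∀ c : Fin (nC K), Sv c ∈ Ioc ((1 - κ (aC K c)) * θCA K c) (θCA K c)) →
            ∑ τ ∈ S.T K, SbsA σ K t τ (fun j => Sv (e K τ j)) ≤ Ssup σ.1 * ∑ τ ∈ S.T K, XsA K t τ (fun j => Sv (e K τ j))) ∧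
        (∀ σ ∈ (Finset.range (Nw + 1)).sigma (fun a => Finset.range (n a)), ∀ K t, |t| ≤ S.l₀ →
          ∀ Sv : Fin (nC K) → ℝ, (∀ c : Fin (nC K), Sv c ∈ Ioc ((1 - κ (aC K c)) * θCA K c) (θCA K c)) →
            ∑ τ ∈ S.T K, SbsB σ K t τ (fun j => θB K τ j / θA K τ j * Sv (e K τ j)) ≤
              Ssup σ.1 * ∑ τ ∈ S.T K, XsB K t τ (fun j => θB K τ j / θA K τ j * Sv (e K τ j))) ∧
        (∀ a ≤ Nw, 0 ≤ Ssup a) ∧ (∀ j, 0 ≤ ρ j) ∧ (∀ j, 0 ≤ r j) ∧ Summable ρ ∧ Summable r ∧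
        S.shA = shellW (fun a => linProfile (κ a)) μ m slot pol θA
          (fun K τ i v => max ((1 - κ (slot K τ i).1) * θA K τ i) (min (θA K τ i) (uA K τ i v)))
          (fun K τ i v => max ((1 - κ (slot K τ i).1) * θA K τ i) (min (θA K τ i) (θA K τ i / θB K τ i * uB K τ i v))) RA ∧
        S.shB = shellW (fun a => linProfile (κ a)) μ m slot pol θA
          (fun K τ i v => max ((1 - κ (slot K τ i).1) * θA K τ i) (min (θA K τ i) (θA K τ i / θB K τ i * uB K τ i v)))
          (fun K τ i v => max ((1 - κ (slot K τ i).1) * θA K τ i) (min (θA K τ i) (uA K τ i v))) RB ∧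
        (∀ K, ∑ a ∈ Finset.range (Nw + 1), (n a : ℝ) * lipWeight (fun a => (κ a)⁻¹) Ssup (fun j => ρ j + r j) a K ≤ S.Wsh K) ∧
        Summable S.Wsh) :
    S_N21 SRec := by
  intro F D g₀ os S hS
  obtain ⟨Ω, mΩ, μ, sf, κ, Nw, n, m, slot, pol, θA, θB, uA, uB, RA, RB, XsA, XsB, ρ, r, Ssup, nC, aC, θCA, e, SbsA, SbsB, hκ, thrA_pos,
    thrB_pos, slot_mem, slot_band, meas, remA_nonneg, remA_int, remB_nonneg, remB_int, hXsA, hXsB, hA, hB, hF, hθ, hSbsA, hSbsB, hθCA, he,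
    he_age, he_thrA, hsharpA, hsharpB, hS0, hρ0, hr0, hρ, hr, hshA, hshB, hWsh, hsum⟩ := hread F D g₀ os S hS
  exact n21_knit_sharpMixture_twoThresholds_commonBox XsA XsB SbsA SbsB hκ thrA_pos thrB_pos slot_mem slot_band meas remA_nonneg remA_int
    remB_nonneg remB_int hXsA hXsB hA hB hF hθ hSbsA hSbsB hθCA he he_age he_thrA hsharpA hsharpB hS0 hρ0 hr0 hρ hr hshA hshB hWsh hsum

end AtCarriers

end Summit.QuantumFields.YangMills.Theorems.N21AtSpineCarriersMixtureTwoThresholdsCommonBox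

end
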